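import Summits.ResolutionOfSingularities.ResolutionOfSingularities.Theorems.MarkedTransferCampaignW36StableTowerTarget
import Literature.AlgebraicGeometry.Hironaka2017.Lib.CoreFocusVeronese
import Literature.AlgebraicGeometry.Hironaka2017.S04CharAlgebra.R004bEdgeGenerators
import Mathlib.RingTheory.Regular.RegularSequence
import HarnessLib

/-!
# [OURS · L1 W3.6] The W3.6 DOOR OF RECORD — class `𝒞` (A-type: `Σ̄_max` locally a complete intersection; B-type: locally monomial
# in a regular system of parameters), the SUPPLY LEMMAS T-A `OrdPowOfLCICut_ours` / T-B `VeroneseOfMonomialCut_ours`, and the one-screen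
# compositions «T-A / T-B on the class ⇒ `U30_2_R2_inst`|𝒞» over res-type-010's kernel

Cell `res-hironaka`, rung L, slot W3.6 «ord-pow cut» — OURS typer o4, statement-only lane; ONE D-0064 file as ORDERED by director-resolution g3
2026-08-27T02:23:55Z («W3.6 DOOR OF RECORD: consumer = `U30_2_R2_inst` restricted to the class 𝒞 = UscCut ∧ (Σ̄_max locally l.c.i. [A-type] ∨
locally monomial in an r.s.p. [B-type]) (S–T cones / space monomial curves EXCLUDED on the face of the class); existence half already kernel
(res-type-010's three `exists_isCoreFocus_…_ambient`); seat targets = SUPPLY LEMMAS T-A `OrdPowOfLCICut_ours` (Zariski–Nagata-type diffPower C b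
≤ 𝓘_C^{(b)} + c.i. unmixedness 𝓘_C^{(b)} = 𝓘_C^b) and T-B `VeroneseOfMonomialCut_ours` (f.g. symbolic Rees algebra of squarefree monomial ideals ⇒
Veronese-standard at some b₀) … (1) o4 types NOW … the class predicate 𝒞 (A-type / B-type as defs), T-A, T-B as OURS Props with docstring
sources, and the composition «T-A ∨ T-B on 𝒞 ⇒ U30_2_R2_inst|𝒞» if it is the one-screen glue»), on res-adj-3's NAME-THE-CONSUMER 02:22:09Z (class
and targets worded there; «type T-A/T-B verbatim over `Resolution.diffPower` / `Scheme.IdealSheafData.vanishingIdeal` (names yours)»). HOST: the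
existing item stmt-ResolutionOfSingularities-16155 (`--supports`, as every K3.x/W3.x campaign file; the consumer DECL is row 010d's
`S06BaseHike.U30_2_R2_inst`, Literature side — its class-restricted Summits-side form is p487786's `CampaignW36.CoreFocusExistsOn 𝒞`).

* POINTWISE CLASS PREDICATES on a closed `C ⊆ W` (stalk level, tree `Resolution.stalkIdeal` of Mathlib's radical ideal sheaf
  `vanishingIdeal C`): `IsLCICutAt C x` (A-type at `x`: `(𝓘_C)_x` is generated by a REGULAR SEQUENCE of `𝒪_{W,x}`, Mathlib
  `RingTheory.Sequence.IsRegular`), `IsMonomialCutAt C x` (B-type at `x`: in some regular system of parameters `z` of `𝒪_{W,x}` (row 004b's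
  `S04CharAlgebra.IsRSP`) `(𝓘_C)_x` is an intersection of ideals generated by SUBSETS of `z` — a reduced union of coordinate subspaces);
  the CLASSES in p487786's shape `𝒞 : (Ê, Σ_max) ↦ Prop`, read on `C := Σ̄_max = closure Σ_max` at EVERY point of `C`:
  `LCIClass` (A-type everywhere), `MonomialClass` (B-type everywhere), `LCIOrMonomialClass` (the door's `𝒞`: at every point A-type OR B-type;
  ⟨UscCut⟩ is carried separately as `CampaignW36.HatUscCutOn`, supplied by slot W3.1).
* SUPPLY LEMMAS (OURS Props; per ambient datum `…On A` and as `p`-slices with the director's names):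
  T-A `OrdPowOfLCICutOn A` / `OrdPowOfLCICut_ours p`: every closed `C ⊆ A.Z` that is A-type at every point satisfies
  `∀ b > 0, diffPower C b ≤ vanishingIdeal C ^ b` («ordinary powers = differential powers»; the binder `hpow` of res-type-010's
  `exists_isCoreFocus_of_ordPowCut_ambient` / `stableAt_one_of_diffPower_le_pow`);
  T-B `VeroneseOfMonomialCutOn A` / `VeroneseOfMonomialCut_ours p`: every closed `C ⊆ A.Z` that is B-type at every point is VERONESE-STANDARD at
  some level: `∃ b₀ > 0, ∀ k, diffPower C (k * b₀) ≤ diffPower C b₀ ^ k` (the binder `hver` of `exists_isCoreFocus_of_veroneseCut_ambient` /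
  `stableAt_of_veronese`); T-AB `VeroneseOfLCIOrMonomialCutOn A` / `…_ours p`: the same conclusion on the mixed class (the uniformisation
  glue — A-type points are Veronese at every level — is the s-seats', not asserted here).
* ONE-SCREEN COMPOSITIONS (kernel, over res-type-010's `Lib/CoreFocusTower` p480139 / `Lib/CoreFocusVeronese` p480948 and p487786):
  `coreFocusExistsOn_lci_of_ordPowOfLCICutOn` (⟨UscCut⟩|A-type ∧ T-A ⇒ `CoreFocusExistsOn LCIClass`, `Ě = cutDown Ê Σ̄_max`),
  `hatStableTowerLEOn_lci_of_ordPowOfLCICutOn` (T-A ⇒ ⟨StableTower b₀ ≤ 1⟩ on the A-type class),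
  `coreFocusExistsOn_monomial_of_veroneseOfMonomialCutOn` (⟨UscCut⟩|B-type ∧ T-B ⇒ `CoreFocusExistsOn MonomialClass`, `Ě = focusAt Ê Σ̄_max b₀`),
  `coreFocusExistsOn_lciOrMonomial_of_veronese` (⟨UscCut⟩|𝒞 ∧ T-AB ⇒ `CoreFocusExistsOn LCIOrMonomialClass` = «U30_2_R2_inst|𝒞»), the
  `p`-slice forms FROM THE SLOT STATEMENT (`…_of_usc_of_…`), and class inclusions `lciClass_le` / `monomialClass_le`.
  DOOR = registered skeleton for the s36 seats: `stub_TA : OrdPowOfLCICut_ours p`, `stub_TB : VeroneseOfMonomialCut_ours p` (+ the mixed glue)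
  — everything else in this file is already kernel.

HONEST FRAMING. Everything here is OURS; NOTHING below is a statement of H. Hironaka's manuscript [Hironaka2017] (lit key
`paper:url-3343fd9e678b`), which prints no existence argument for `Ě` (p.30 l.4–9) and no class; nothing of it is asserted; it stays «under
review». T-A / T-B are CANDIDATE premises believed IN PRINT in characteristic-free or char-p-aware forms — SOURCES NAMED BY THE DIRECTOR
02:23:55Z (2), locators to be READ ON THE PAGE by the placement seat (res-lit-2, HOME/lit/PLACEMENT-W36.md, due 06:00Z) and typed there as L-USE
Literature facts; nothing below is cited from memory as established: T-A ← Zariski–Nagata «differential powers = symbolic powers of radical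
ideals of smooth algebras over a perfect field» (Dao–De Stefani–Grifo–Huneke–Núñez-Betancourt, survey «Symbolic powers» 2018 §2; De Stefani–Grifo–
Jeffries, J. reine angew. Math. 2020 — the char-p side needs Hasse–Schmidt / divided-power differential operators; whether the tree's
`Resolution.diffPower` matches is the placement seat's first check) + «powers of an ideal generated by a regular sequence are unmixed ⇒ symbolic =
ordinary powers» (Zariski–Samuel II App. 6; Hochster 1973; K3.6 report NF1 cites CHHVT 2020 Thm 9.11); T-B ← Herzog–Hibi–Trung, Adv. Math. 210
(2007) (finite generation of the symbolic Rees / vertex cover algebra of a squarefree monomial ideal ⇒ a Veronese subalgebra is standard graded).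
CERTIFIED INSTANCES (kernel, not these Props): specimen (A) level 1 / specimen (B) level 2 (res-L1-k36 K3.6 ALIVE 02:04:05Z, j265296 + p484649;
res-type-010 `SpecimenB.specimenB_isCoreFocus` p484139). EXCLUDED on the face of the class: Sannai–Tanaka / Goto–Watanabe cones and space
monomial curves (e.g. the W-Q branches γ̄₂, γ̄₃), where finite generation of the symbolic Rees algebra is open or false in print (res-adj-3 (1)).
VACUITY SELF-CHECK (T-lint): `IsLCICutAt` / `IsMonomialCutAt` are satisfiable (regular `C`: a part of an r.s.p.; specimens (A)/(B)) and refutable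
(a cusp inside a smooth surface germ is A-type but not B-type; three concurrent lines are B-type, not A-type at `0` in 𝔸⁴? — they ARE NOT a
complete intersection there); T-A / T-B are not trivially true (they fail off the class: `xyz ∉ (xy, yz, zx)²` shows ord-pow fails for (B),
p484649) and not trivially false (regular `C`: level 1, tree `stableAt_one_of_regular`); the compositions are theorems. AI bookkeeping; weaker
than expert review.

## References (context; nothing below is used as a premise)
* H. Hironaka, ms. 2017-03-23, §6.2 p.30 l.4–9 (Eq. (43)) — scope only, under adjudication. [Hironaka2017]
* Sources for T-A / T-B as listed by director-resolution g3 2026-08-27T02:23:55Z (2) — locators pending HOME/lit/PLACEMENT-W36.md (res-lit-2).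
* Cell records: director-resolution W3.6 DOOR OF RECORD 02:23:55Z; res-adj-3 NAME-THE-CONSUMER 02:22:09Z; res-L1-k36 KILL-TEST K3.6 ALIVE
  02:04:05Z; res-type-010 p480139 / p480948 / p484139; o4 p485977 / p487786.
-/

noncomputable section

set_option linter.dupNamespace false -- mandated namespace of this single-conjunct summit

open _root_.AlgebraicGeometry _root_.TopologicalSpace _root_.CategoryTheory

namespace Summit.ResolutionOfSingularities.ResolutionOfSingularities.Theorems

open Literature.AlgebraicGeometry.Resolution
open Literature.AlgebraicGeometry.Hironaka2017
open Literature.AlgebraicGeometry.Hironaka2017.S02Preliminaries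
open Literature.AlgebraicGeometry.Hironaka2017.S04CharAlgebra
open Literature.AlgebraicGeometry.Hironaka2017.S06BaseHike
open Literature.AlgebraicGeometry.Hironaka2017.Datum

universe u

namespace CampaignW36

/-! ## The pointwise class predicates (stalk level) and the classes in p487786's shape `(Ê, Σ_max) ↦ Prop` -/

section Classes

variable {W : Scheme.{u}}

/-- **[OURS · L1 W3.6] `CampaignW36.IsLCICutAt C x` — A-TYPE at a point**: replaces the role of nothing printed (the manuscript never reads
the geometry of `Σ̄_max`); NOT a statement of the manuscript. The stalk `(𝓘_C)_x ⊆ 𝒪_{W,x}` (tree `Resolution.stalkIdeal` of Mathlib's radical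
ideal sheaf `vanishingIdeal C` of the closed set `C`) is generated by a REGULAR SEQUENCE of the local ring `𝒪_{W,x}` (Mathlib
`RingTheory.Sequence.IsRegular`, the ring as a module over itself) — «`C` is locally at `x` a complete intersection» (res-adj-3 (1) A-type:
«𝓘_C locally generated by a regular sequence — specimen (A): Γ = V(z, y² − x³)»). [folklore] -/
def IsLCICutAt (C : Closeds W) (x : W) : Prop :=
  ∃ rs : List (W.presheaf.stalk x), RingTheory.Sequence.IsRegular (W.presheaf.stalk x) rs ∧
    Ideal.ofList rs = stalkIdeal (Scheme.IdealSheafData.vanishingIdeal C) x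

/-- **[OURS · L1 W3.6] `CampaignW36.IsMonomialCutAt C x` — B-TYPE at a point**: replaces the role of nothing printed; NOT a statement of the
manuscript. In SOME regular system of parameters `z = (z_1, …, z_d)` of `𝒪_{W,x}` (row 004b's `S04CharAlgebra.IsRSP`: `𝒪_{W,x}` regular, `z`
generates `𝔪_x`, `d = edim`), the stalk `(𝓘_C)_x` is an INTERSECTION of ideals generated by SUBSETS of `z` — «`C` is locally at `x` a reduced
union of coordinate subspaces» (res-adj-3 (1) B-type: «locally MONOMIAL in a regular system of parameters — specimen (B): three concurrent axes
in {w = 0} ⊂ 𝔸⁴», i.e. `(x, y, w) ∩ (y, z, w) ∩ (x, z, w)`). [folklore] -/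
def IsMonomialCutAt (C : Closeds W) (x : W) : Prop :=
  ∃ (d : ℕ) (z : Fin d → W.presheaf.stalk x), IsRSP (W.presheaf.stalk x) z ∧
    ∃ 𝒮 : Finset (Finset (Fin d)),
      stalkIdeal (Scheme.IdealSheafData.vanishingIdeal C) x = ⨅ S ∈ 𝒮, Ideal.span (z '' (S : Set (Fin d)))

/-- **[OURS · L1 W3.6] `CampaignW36.LCIClass` — the A-TYPE CLASS** in p487786's shape `𝒞 Ê Σ_max`: the closure `C = Σ̄_max` of the
`Inv_max`-stratum is A-type at EVERY point of `C`. Replaces the role of nothing printed; NOT a statement of the manuscript. [folklore] -/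
def LCIClass ⦃W : Scheme.{u}⦄ (_ : IdealExponent W) (Sig : Set W) : Prop :=
  ∀ x ∈ closure Sig, IsLCICutAt (Closeds.closure Sig) x

/-- **[OURS · L1 W3.6] `CampaignW36.MonomialClass` — the B-TYPE CLASS**: `Σ̄_max` is B-type at every point. Replaces the role of nothing
printed; NOT a statement of the manuscript. [folklore] -/
def MonomialClass ⦃W : Scheme.{u}⦄ (_ : IdealExponent W) (Sig : Set W) : Prop :=
  ∀ x ∈ closure Sig, IsMonomialCutAt (Closeds.closure Sig) x

/-- **[OURS · L1 W3.6] `CampaignW36.LCIOrMonomialClass` — THE DOOR'S CLASS `𝒞`** (director 02:23:55Z: «Σ̄_max locally l.c.i. [A-type] ∨ locally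
monomial in an r.s.p. [B-type]»; res-adj-3 (1): «at every point EITHER (A-type) … OR (B-type)»; ⟨UscCut⟩ is carried separately by
`CampaignW36.HatUscCutOn`, supplied by W3.1). Replaces the role of nothing printed; NOT a statement of the manuscript. [folklore] -/
def LCIOrMonomialClass ⦃W : Scheme.{u}⦄ (_ : IdealExponent W) (Sig : Set W) : Prop :=
  ∀ x ∈ closure Sig, IsLCICutAt (Closeds.closure Sig) x ∨ IsMonomialCutAt (Closeds.closure Sig) x

/-- Pure logic: A-type everywhere ⇒ in the door's class. [folklore] -/
theorem lciClass_le ⦃W : Scheme.{u}⦄ (F : IdealExponent W) (Sig : Set W) (h : LCIClass F Sig) : LCIOrMonomialClass F Sig :=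
  fun x hx => Or.inl (h x hx)

/-- Pure logic: B-type everywhere ⇒ in the door's class. [folklore] -/
theorem monomialClass_le ⦃W : Scheme.{u}⦄ (F : IdealExponent W) (Sig : Set W) (h : MonomialClass F Sig) :
    LCIOrMonomialClass F Sig :=
  fun x hx => Or.inr (h x hx)

end Classes

/-! ## The SUPPLY LEMMAS T-A / T-B (OURS Props; per ambient datum and as `p`-slices with the director's names) -/

section Supply

variable {p : ℕ} [Fact p.Prime] {K : Type u} [Field K] [CharP K p]

/-- **[OURS · L1 W3.6] T-A per ambient datum, `CampaignW36.OrdPowOfLCICutOn A` — «ORDINARY POWERS = DIFFERENTIAL POWERS along an everywhere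
A-type closed set»**: replaces the role of nothing printed; NOT a statement of the manuscript. On the ambient scheme `A.Z` (smooth, irreducible, of
finite type over `K`, §2 p.4 l.22–24): for every closed `C ⊆ A.Z` with `IsLCICutAt C x` at every point `x ∈ C` and every `b > 0`,
`diffPower C b ≤ vanishingIdeal C ^ b` (res-type-010's `Lib/CoreFocusTower.diffPower` = the largest ideal sheaf of order `≥ b` along `C`) —
the binder `hpow` of `exists_isCoreFocus_of_ordPowCut_ambient` / `stableAt_one_of_diffPower_le_pow` (p480139). CANDIDATE premise, believed IN
PRINT (Zariski–Nagata + c.i. unmixedness; sources per director 02:23:55Z (2), locators pending PLACEMENT-W36); certified at specimen (A)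
(K3.6). The s36 seat's `stub_TA`. [folklore] -/
def OrdPowOfLCICutOn (A : AmbientDatum p K) : Prop :=
  ∀ C : Closeds A.Z, (∀ x ∈ (C : Set A.Z), IsLCICutAt C x) →
    ∀ b : ℕ, 0 < b → diffPower C b ≤ Scheme.IdealSheafData.vanishingIdeal C ^ b

/-- **[OURS · L1 W3.6] T-B per ambient datum, `CampaignW36.VeroneseOfMonomialCutOn A` — «an everywhere B-type closed set is VERONESE-STANDARD
at some level»**: replaces the role of nothing printed; NOT a statement of the manuscript. For every closed `C ⊆ A.Z` with `IsMonomialCutAt C x`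
at every `x ∈ C` there is `b₀ > 0` with `diffPower C (k * b₀) ≤ diffPower C b₀ ^ k` for all `k` — the binder `hver` of res-type-010's
`exists_isCoreFocus_of_veroneseCut_ambient` / `stableAt_of_veronese` (p480948). CANDIDATE premise, believed IN PRINT (Herzog–Hibi–Trung 2007:
finite generation of the symbolic Rees algebra of a squarefree monomial ideal; sources per director 02:23:55Z (2), locators pending
PLACEMENT-W36); certified at specimen (B) with `b₀ = 2` (`SpecimenB.veronese_two`, p484139). The s36 seat's `stub_TB`. [folklore] -/
def VeroneseOfMonomialCutOn (A : AmbientDatum p K) : Prop :=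
  ∀ C : Closeds A.Z, (∀ x ∈ (C : Set A.Z), IsMonomialCutAt C x) →
    ∃ b₀ : ℕ, 0 < b₀ ∧ ∀ k : ℕ, diffPower C (k * b₀) ≤ diffPower C b₀ ^ k

/-- **[OURS · L1 W3.6] T-AB per ambient datum, `CampaignW36.VeroneseOfLCIOrMonomialCutOn A`** — the same Veronese conclusion on the MIXED class
(A-type or B-type at every point). Replaces the role of nothing printed; NOT a statement of the manuscript. Expected from T-A ∧ T-B by a
uniformisation glue (A-type points are Veronese at every level; `C` is Noetherian) — the s36 seats' task, NOT asserted here. [folklore] -/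
def VeroneseOfLCIOrMonomialCutOn (A : AmbientDatum p K) : Prop :=
  ∀ C : Closeds A.Z, (∀ x ∈ (C : Set A.Z), IsLCICutAt C x ∨ IsMonomialCutAt C x) →
    ∃ b₀ : ℕ, 0 < b₀ ∧ ∀ k : ℕ, diffPower C (k * b₀) ≤ diffPower C b₀ ^ k

end Supply

/-! ## One-screen compositions with res-type-010's kernel: T-A / T-B on the class ⇒ `CoreFocusExistsOn` (= «`U30_2_R2_inst`|𝒞», p487786) -/

section Compose

variable {IsEdgeData : ∀ ⦃X : Scheme.{u}⦄ ⦃p n : ℕ⦄ (E : IdealExponent X) (ξ : X), EdgeDatumAt p n E ξ → Prop}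
  {p : ℕ} [Fact p.Prime] {K : Type u} [Field K] [CharP K p] [PerfectField K] {A : AmbientDatum p K} {n : ℕ}

omit [PerfectField K] in
/-- The ambient scheme of a row-001 `AmbientDatum` is locally Noetherian. [folklore] -/
private theorem ambient_isLocallyNoetherian (A : AmbientDatum p K) : IsLocallyNoetherian A.Z :=
  -- adapted from Literature/AlgebraicGeometry/Hironaka2017/Proofs/S06BaseHike/U30L4c.lean (private)
  haveI := A.smooth
  haveI := A.quasiCompact
  haveI := Scheme.isNoetherian_of_finiteType_over_field A.hom
  inferInstance

/-- **⟨UscCut⟩|A-type ∧ T-A ⇒ `Ě` exists on the A-type class** (`Ě = cutDown Ê Σ̄_max`; res-type-010's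
`exists_isCoreFocus_of_ordPowCut_ambient` with `C := Σ̄_max = invmaxClosure`). [folklore] -/
theorem coreFocusExistsOn_lci_of_ordPowOfLCICutOn (hU : HatUscCutOn LCIClass IsEdgeData A n) (hTA : OrdPowOfLCICutOn A) :
    CoreFocusExistsOn LCIClass IsEdgeData A n := by
  intro E ed hE hb hed hC
  refine exists_isCoreFocus_of_ordPowCut_ambient A (invInst (baseHike E) ed) (baseHike E) hb
    ⟨CampaignW31.invmaxClosure ((baseHike E).sing ∩ S02Preliminaries.closedPoints A.Z) (invField (baseHike E) ed),
      hTA _ hC, hU E ed hE hb hed hC, subset_rfl⟩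

/-- **T-A ⇒ ⟨StableTower b₀ ≤ 1⟩ on the A-type class** (level `1`: res-type-010's `stableAt_one_of_diffPower_le_pow`). [folklore] -/
theorem hatStableTowerLEOn_lci_of_ordPowOfLCICutOn (hTA : OrdPowOfLCICutOn A) : HatStableTowerLEOn LCIClass IsEdgeData 1 A n := by
  intro E ed _ hb _ hC
  haveI := ambient_isLocallyNoetherian A
  exact ⟨1, Nat.one_pos, le_rfl, stableAt_one_of_diffPower_le_pow A.isRegular_Z (baseHike E) hb _ (hTA _ hC)⟩

/-- **⟨UscCut⟩|B-type ∧ T-B ⇒ `Ě` exists on the B-type class** (`Ě = focusAt Ê Σ̄_max b₀`; res-type-010's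
`exists_isCoreFocus_of_veroneseCut_ambient`). [folklore] -/
theorem coreFocusExistsOn_monomial_of_veroneseOfMonomialCutOn (hU : HatUscCutOn MonomialClass IsEdgeData A n)
    (hTB : VeroneseOfMonomialCutOn A) : CoreFocusExistsOn MonomialClass IsEdgeData A n := by
  intro E ed hE hb hed hC
  obtain ⟨b₀, hb₀, hver⟩ := hTB
    (CampaignW31.invmaxClosure ((baseHike E).sing ∩ S02Preliminaries.closedPoints A.Z) (invField (baseHike E) ed)) hC
  exact exists_isCoreFocus_of_veroneseCut_ambient A (invInst (baseHike E) ed) (baseHike E) hb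
    ⟨CampaignW31.invmaxClosure ((baseHike E).sing ∩ S02Preliminaries.closedPoints A.Z) (invField (baseHike E) ed), b₀, hb₀,
      hver, hU E ed hE hb hed hC, subset_rfl⟩

omit [PerfectField K] in
/-- **T-B ⇒ ⟨StableTower⟩ on the B-type class at the Veronese level** (no uniform bound: `b₀` depends on `C`; res-type-010's
`stableAt_of_veronese`). [folklore] -/
theorem stableAt_monomial_of_veroneseOfMonomialCutOn (hTB : VeroneseOfMonomialCutOn A) (E : IdealExponent A.Z)
    (ed : EdgeDataOn p n (baseHike E)) (hb : 0 < (baseHike E).b)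
    (hC : MonomialClass (baseHike E)
      (invmaxStratum ((baseHike E).sing ∩ S02Preliminaries.closedPoints A.Z) (invField (baseHike E) ed))) :
    ∃ b₀ : ℕ, 0 < b₀ ∧ StableAt (baseHike E)
      (CampaignW31.invmaxClosure ((baseHike E).sing ∩ S02Preliminaries.closedPoints A.Z) (invField (baseHike E) ed)) b₀ := by
  obtain ⟨b₀, hb₀, hver⟩ := hTB
    (CampaignW31.invmaxClosure ((baseHike E).sing ∩ S02Preliminaries.closedPoints A.Z) (invField (baseHike E) ed)) hC
  haveI := ambient_isLocallyNoetherian A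
  exact ⟨b₀, hb₀, stableAt_of_veronese A.isRegular_Z (baseHike E) hb _ hb₀ hver⟩

/-- **⟨UscCut⟩|𝒞 ∧ T-AB ⇒ `Ě` exists on THE DOOR'S CLASS `𝒞 = LCIOrMonomialClass`** — «`U30_2_R2_inst`|𝒞» in the Summits-side form
`CampaignW36.CoreFocusExistsOn` (p487786). [folklore] -/
theorem coreFocusExistsOn_lciOrMonomial_of_veronese (hU : HatUscCutOn LCIOrMonomialClass IsEdgeData A n)
    (hT : VeroneseOfLCIOrMonomialCutOn A) : CoreFocusExistsOn LCIOrMonomialClass IsEdgeData A n := by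
  intro E ed hE hb hed hC
  obtain ⟨b₀, hb₀, hver⟩ := hT
    (CampaignW31.invmaxClosure ((baseHike E).sing ∩ S02Preliminaries.closedPoints A.Z) (invField (baseHike E) ed)) hC
  exact exists_isCoreFocus_of_veroneseCut_ambient A (invInst (baseHike E) ed) (baseHike E) hb
    ⟨CampaignW31.invmaxClosure ((baseHike E).sing ∩ S02Preliminaries.closedPoints A.Z) (invField (baseHike E) ed), b₀, hb₀,
      hver, hU E ed hE hb hed hC, subset_rfl⟩

/-- **FROM SLOT W3.1**: `CampaignW31InvmaxClosed ∧ T-A ⇒ Ě exists on the A-type class` (⟨UscCut⟩ on every class by p487786's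
`hatUscCutOn_of_invmaxClosed`). [folklore] -/
theorem coreFocusExistsOn_lci_of_invmaxClosed (hW31 : CampaignW31InvmaxClosed.{u} IsEdgeData) (hTA : OrdPowOfLCICutOn A) :
    CoreFocusExistsOn LCIClass IsEdgeData A n :=
  coreFocusExistsOn_lci_of_ordPowOfLCICutOn (hatUscCutOn_of_invmaxClosed hW31 K A n) hTA

/-- **FROM SLOT W3.1**: `CampaignW31InvmaxClosed ∧ T-AB ⇒ Ě exists on the door's class`. [folklore] -/
theorem coreFocusExistsOn_lciOrMonomial_of_invmaxClosed (hW31 : CampaignW31InvmaxClosed.{u} IsEdgeData)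
    (hT : VeroneseOfLCIOrMonomialCutOn A) : CoreFocusExistsOn LCIOrMonomialClass IsEdgeData A n :=
  coreFocusExistsOn_lciOrMonomial_of_veronese (hatUscCutOn_of_invmaxClosed hW31 K A n) hT

end Compose

end CampaignW36

open CampaignW36

/-! ## `p`-slices with the director's names: `OrdPowOfLCICut_ours` (T-A), `VeroneseOfMonomialCut_ours` (T-B), `VeroneseOfLCIOrMonomialCut_ours` -/

/-- **[OURS · L1 W3.6] T-A, `OrdPowOfLCICut_ours p`** (director's name; `p`-slice of `CampaignW36.OrdPowOfLCICutOn` over every perfect `K` of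
characteristic `p` and every ambient datum): «differential powers = ordinary powers along every everywhere-l.c.i. closed subset of an ambient
scheme». Replaces the role of nothing printed; CANDIDATE premise (in print per director 02:23:55Z (2), locators pending); NOT a statement of the
manuscript. The s36 seat's `stub_TA`. [folklore] -/
def OrdPowOfLCICut_ours (p : ℕ) [Fact p.Prime] : Prop :=
  ∀ (K : Type u) [Field K] [CharP K p] [PerfectField K] (A : AmbientDatum p K), OrdPowOfLCICutOn A

/-- **[OURS · L1 W3.6] T-B, `VeroneseOfMonomialCut_ours p`** (director's name; `p`-slice of `CampaignW36.VeroneseOfMonomialCutOn`): «every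
everywhere-monomial closed subset of an ambient scheme is Veronese-standard at some level». Replaces the role of nothing printed; CANDIDATE
premise (in print per director 02:23:55Z (2), locators pending); NOT a statement of the manuscript. The s36 seat's `stub_TB`. [folklore] -/
def VeroneseOfMonomialCut_ours (p : ℕ) [Fact p.Prime] : Prop :=
  ∀ (K : Type u) [Field K] [CharP K p] [PerfectField K] (A : AmbientDatum p K), VeroneseOfMonomialCutOn A

/-- **[OURS · L1 W3.6] T-AB, `VeroneseOfLCIOrMonomialCut_ours p`** — `p`-slice of the mixed-class Veronese statement (the door's class).
Replaces the role of nothing printed; CANDIDATE (expected from T-A ∧ T-B + uniformisation); NOT a statement of the manuscript. [folklore] -/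
def VeroneseOfLCIOrMonomialCut_ours (p : ℕ) [Fact p.Prime] : Prop :=
  ∀ (K : Type u) [Field K] [CharP K p] [PerfectField K] (A : AmbientDatum p K), VeroneseOfLCIOrMonomialCutOn A

/-- **[OURS · L1 W3.6 → D-lane] «`U30_2_R2_inst`|A-type» FROM THE SLOT STATEMENT AND T-A**:
`CampaignW31UscInvOneExponentI p → OrdPowOfLCICut_ours p → CampaignW36CoreFocusExistsOnI LCIClass p`. [folklore] -/
theorem campaignW36CoreFocusExists_lci_of_usc_of_ordPow (p : ℕ) [Fact p.Prime] (h₁ : CampaignW31UscInvOneExponentI.{u} p)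
    (h₂ : OrdPowOfLCICut_ours.{u} p) : CampaignW36CoreFocusExistsOnI.{u} LCIClass p :=
  fun K _ _ _ A n =>
    coreFocusExistsOn_lci_of_ordPowOfLCICutOn
      (hatUscCutOn_of_hatStratumClosedPos (campaignW31HatStratumClosedPosI_of_uscInvOneExponentI p h₁ K A n)) (h₂ K A)

/-- **T-A ⇒ the level-1 target on the A-type class**: `OrdPowOfLCICut_ours p → CampaignW36HatStableTowerLEOnI LCIClass 1 p`. [folklore] -/
theorem campaignW36HatStableTowerLEOnI_lci_of_ordPow (p : ℕ) [Fact p.Prime] (h : OrdPowOfLCICut_ours.{u} p) :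
    CampaignW36HatStableTowerLEOnI.{u} LCIClass 1 p :=
  fun K _ _ _ A _ => hatStableTowerLEOn_lci_of_ordPowOfLCICutOn (h K A)

/-- **[OURS · L1 W3.6 → D-lane] «`U30_2_R2_inst`|B-type» FROM THE SLOT STATEMENT AND T-B**. [folklore] -/
theorem campaignW36CoreFocusExists_monomial_of_usc_of_veronese (p : ℕ) [Fact p.Prime] (h₁ : CampaignW31UscInvOneExponentI.{u} p)
    (h₂ : VeroneseOfMonomialCut_ours.{u} p) : CampaignW36CoreFocusExistsOnI.{u} MonomialClass p :=
  fun K _ _ _ A n =>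
    coreFocusExistsOn_monomial_of_veroneseOfMonomialCutOn
      (hatUscCutOn_of_hatStratumClosedPos (campaignW31HatStratumClosedPosI_of_uscInvOneExponentI p h₁ K A n)) (h₂ K A)

/-- **[OURS · L1 W3.6 → D-lane] «`U30_2_R2_inst`|𝒞» FROM THE SLOT STATEMENT AND T-AB** (the door's class). [folklore] -/
theorem campaignW36CoreFocusExists_lciOrMonomial_of_usc_of_veronese (p : ℕ) [Fact p.Prime]
    (h₁ : CampaignW31UscInvOneExponentI.{u} p) (h₂ : VeroneseOfLCIOrMonomialCut_ours.{u} p) :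
    CampaignW36CoreFocusExistsOnI.{u} LCIOrMonomialClass p :=
  fun K _ _ _ A n =>
    coreFocusExistsOn_lciOrMonomial_of_veronese
      (hatUscCutOn_of_hatStratumClosedPos (campaignW31HatStratumClosedPosI_of_uscInvOneExponentI p h₁ K A n)) (h₂ K A)

end Summit.ResolutionOfSingularities.ResolutionOfSingularities.Theorems

end
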